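import Summits.BirchSwinnertonDyer.BirchSwinnertonDyer.Theses.ShaPrimaryTransfer
import Summits.BirchSwinnertonDyer.BirchSwinnertonDyer.Theorems.Rank1ResidualIntModelReduction
import Summits.BirchSwinnertonDyer.Rank1Residual.Additive.PointCountEulerNat
import Literature.NumberTheory.EllipticCurves.Zywina2025Torsion
import Literature.NumberTheory.EllipticCurves.Kato2004.ShaFiniteOfOrderLeRankProofs

/-!
# BirchSwinnertonDyer / ShaPrimaryTransfer — crux `FiniteShaComponentTransfer` (stmt-BirchSwinnertonDyer-22356):
# `q = 5` is a good ORDINARY prime of EVERY curve of Zywina's rank-2 family — a uniform target for the transfer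

Companions `…RankTwoDoor` (door at `2` open at rank `2` on `E_{m,n}`, kernel-certified), `…CrossPrimeRow` (the row at an
odd good ordinary `q`), `…RowAtFive` (the explicit cell `(E_{659,12}, 2, 5)`). Here the target prime `q = 5` is shown
to be available UNIFORMLY on the family: for every admissible `(m, n)` (so `m, q = m+16n², r = m+25n²` are primes
`≡ 11 (mod 24)`, in particular none is `5`), the global minimal model `E_{m,n} : y² = x³ − 5q x² + 4qr x` reduces
modulo `5` to `y² = x³ + c x` with `c ≡ 4qr ≢ 0 (mod 5)` — a curve with `j = 1728`, ORDINARY at `5 ≡ 1 (mod 4)`: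
`#Ẽ(𝔽₅) ∈ {4, 2, 10, 8}` for `c ≡ 1, 2, 3, 4`, i.e. `a₅(E_{m,n}) ∈ {2, 4, −4, −2}`.

* `five_not_dvd_Δ_zywinaCurveInt` — `5 ∤ Δ(E_{m,n}) = 2⁸·3²·m·q³·r²`.
* `map_zywinaCurveInt_zmod_five` — `E_{m,n} mod 5 = [0,0,0,c,0] mod 5`, `c = (4qr) % 5`.
* `natCard_five_of_residue` — the four point counts, kernel-decided (`PointCountNat.natCard_point_map_eq`).
* `goodOrdinary_five_zywinaCurve` — **`5` is a prime of good ordinary reduction of `E_{m,n}`, for every admissible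
  `(m, n)`** (unconditional). Hence X2 (`AnalyticRankLeSelmerCorank`), Kato's Thm. 18.4 and the `λ`-door dock at the
  SAME prime `q = 5` across the whole family:
* `crossPrimeRow_five_zywinaCurve` — granting Kato 18.4 at `5` and `[T²] L_5(E_{m,n}, T) ≠ 0`: `t_5(E_{m,n}) = 0`
  (T's instance `(E_{m,n}, 2, 5)` verified modulo print + one certificate per curve);
* `analyticRank_zywinaCurve_le_of_X2_five` — granting X2: `ord_{s=1} L(E_{m,n}, s) ≤ 2 + t_5(E_{m,n})`, and `≤ 2`
  granting also T (`…_of_transfer`).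

Prover seat `bsd-line-spt-p1` g2, `--supports stmt-22356 --as helper`. Nothing here proves T, X2 or BSD.

References: D. Zywina, arXiv:2502.01957 (2025), Thm. 1.2, §3; J. H. Silverman, *AEC* (2009), V.4 (ordinary iff
`a_p ≢ 0`), VII.5.1; K. Ireland, M. Rosen, GTM 84 (1990), §18.4 (`y² = x³ + Dx` at `p ≡ 1 mod 4`); K. Kato,
Astérisque 295 (2004), Thm. 18.4.
-/

-- D-0017: single-problem summit, so `Summit.BirchSwinnertonDyer.BirchSwinnertonDyer.…` repeats a namespace BY DESIGN.
set_option linter.dupNamespace false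

noncomputable section

namespace Summit.BirchSwinnertonDyer.BirchSwinnertonDyer.Theorems.ShaPrimaryTransferGoodOrdinaryFive

open scoped Classical MatrixGroups ModularForm
open CongruenceSubgroup
open Literature.NumberTheory.EllipticCurves Literature.NumberTheory.EllipticCurves.Zywina2025
  Literature.NumberTheory.EllipticCurves.ModularForms
open WeierstrassCurve
open Summit.BirchSwinnertonDyer.BirchSwinnertonDyer.Rank1Residual
open Summit.BirchSwinnertonDyer.Rank1Residual.Additive
open Summit.BirchSwinnertonDyer.BirchSwinnertonDyer.Theses.ShaPrimaryTransfer
  (FiniteShaComponentTransfer AnalyticRankLeSelmerCorank)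

variable {m n : ℕ}

/-! ## `5 ∤ Δ(E_{m,n})` -/

/-- A prime `k ≡ 11 (mod 24)` is not `5`, hence (being prime) is not divisible by `5`. [folklore] -/
theorem five_not_dvd_of_prime_of_mod {k : ℕ} (hk : k.Prime) (hmod : k % 24 = 11) : ¬ (5 : ℤ) ∣ (k : ℤ) := by
  intro h
  have h' : 5 ∣ k := by exact_mod_cast h
  have := (Nat.prime_dvd_prime_iff_eq Nat.prime_five hk).1 h'
  omega

/-- **`5 ∤ Δ(E_{m,n}) = 2⁸·3²·m·q³·r²`** for admissible `(m, n)` (`m, q, r` primes `≡ 11 (mod 24)`).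
[cite: Zywina2025, §3 (discriminant of E_{m,n})] -/
theorem five_not_dvd_Δ_zywinaCurveInt (h : ZywinaAdmissible m n) : ¬ (5 : ℤ) ∣ (zywinaCurveInt m n).Δ := by
  have P := h.params
  have h5 : Prime (5 : ℤ) := Int.prime_iff_natAbs_prime.2 (by norm_num)
  have hm := five_not_dvd_of_prime_of_mod P.m_prime P.m_mod
  have hq := five_not_dvd_of_prime_of_mod P.q_prime P.q_mod
  have hr := five_not_dvd_of_prime_of_mod P.r_prime P.r_mod
  rw [zywinaCurveInt_Δ]
  intro hd
  rcases h5.dvd_or_dvd hd with h1 | h1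
  · rcases h5.dvd_or_dvd h1 with h2 | h2
    · rcases h5.dvd_or_dvd h2 with h3 | h3
      · rcases h5.dvd_or_dvd h3 with h4 | h4
        · exact absurd (Int.Prime.dvd_pow' (by norm_num) h4) (by norm_num)
        · exact absurd (Int.Prime.dvd_pow' (by norm_num) h4) (by norm_num)
      · exact hm h3
    · exact hq (h5.dvd_of_dvd_pow h2)
  · exact hr (h5.dvd_of_dvd_pow h1)

/-! ## The reduction modulo `5` -/

/-- **`E_{m,n} mod 5 = [0, 0, 0, c, 0] mod 5` with `c = (4qr) % 5`**: `a₂ = −5q ≡ 0`, `a₄ = 4qr ≡ c`. [folklore] -/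
theorem map_zywinaCurveInt_zmod_five (m n : ℕ) :
    (zywinaCurveInt m n).map (Int.castRingHom (ZMod 5)) =
      ((⟨0, 0, 0, (4 * ((m + 16 * n ^ 2 : ℕ) : ℤ) * ((m + 25 * n ^ 2 : ℕ) : ℤ)) % 5, 0⟩ : WeierstrassCurve ℤ).map
        (Int.castRingHom (ZMod 5))) := by
  ext
  · simp [zywinaCurveInt]
  · simp only [zywinaCurveInt, map_a₂, eq_intCast]
    push_cast
    have h5 : (5 : ZMod 5) = 0 := by decide
    simp [h5]
  · simp [zywinaCurveInt]
  · simp only [zywinaCurveInt, map_a₄, eq_intCast]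
    exact (ZMod.intCast_mod _ 5).symm
  · simp [zywinaCurveInt]

/-- The residue `c = (4qr) % 5` is one of `1, 2, 3, 4` (`5 ∤ 4qr`). [folklore] -/
theorem residue_five_mem (h : ZywinaAdmissible m n) :
    (4 * ((m + 16 * n ^ 2 : ℕ) : ℤ) * ((m + 25 * n ^ 2 : ℕ) : ℤ)) % 5 = 1 ∨
      (4 * ((m + 16 * n ^ 2 : ℕ) : ℤ) * ((m + 25 * n ^ 2 : ℕ) : ℤ)) % 5 = 2 ∨
      (4 * ((m + 16 * n ^ 2 : ℕ) : ℤ) * ((m + 25 * n ^ 2 : ℕ) : ℤ)) % 5 = 3 ∨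
      (4 * ((m + 16 * n ^ 2 : ℕ) : ℤ) * ((m + 25 * n ^ 2 : ℕ) : ℤ)) % 5 = 4 := by
  have P := h.params
  have h5 : Prime (5 : ℤ) := Int.prime_iff_natAbs_prime.2 (by norm_num)
  have hq := five_not_dvd_of_prime_of_mod P.q_prime P.q_mod
  have hr := five_not_dvd_of_prime_of_mod P.r_prime P.r_mod
  rw [← P.q_eq] at hq ⊢
  rw [← P.r_eq] at hr ⊢
  have hne : (4 * ((m + 16 * n ^ 2 : ℕ) : ℤ) * ((m + 25 * n ^ 2 : ℕ) : ℤ)) % 5 ≠ 0 := by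
    rw [← P.q_eq, ← P.r_eq]
    intro h0
    have hd : (5 : ℤ) ∣ 4 * (_ : ℤ) * _ := Int.dvd_of_emod_eq_zero h0
    rcases h5.dvd_or_dvd hd with h1 | h1
    · rcases h5.dvd_or_dvd h1 with h2 | h2
      · exact absurd h2 (by norm_num)
      · exact hq h2
    · exact hr h1
  rw [← P.q_eq, ← P.r_eq] at hne
  omega

/-- **The four point counts over `𝔽₅`** of `y² = x³ + c x`, `c = 1, 2, 3, 4`: `4, 2, 10, 8` (kernel-decided).
[cite: IrelandRosen1990, §18.4] -/
theorem natCard_five_of_residue (c : ℤ) (hc : c = 1 ∨ c = 2 ∨ c = 3 ∨ c = 4) :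
    ¬ (5 : ℤ) ∣ (5 : ℤ) + 1 -
      (Nat.card (((⟨0, 0, 0, c, 0⟩ : WeierstrassCurve ℤ).map (Int.castRingHom (ZMod 5))).toAffine.Point) : ℕ) := by
  rcases hc with rfl | rfl | rfl | rfl
  · rw [PointCountNat.natCard_point_map_eq (hℓ := ⟨by norm_num⟩) (by norm_num) 0 0 0 1 0 (by decide +kernel)]
    decide +kernel
  · rw [PointCountNat.natCard_point_map_eq (hℓ := ⟨by norm_num⟩) (by norm_num) 0 0 0 2 0 (by decide +kernel)]
    decide +kernel
  · rw [PointCountNat.natCard_point_map_eq (hℓ := ⟨by norm_num⟩) (by norm_num) 0 0 0 3 0 (by decide +kernel)]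
    decide +kernel
  · rw [PointCountNat.natCard_point_map_eq (hℓ := ⟨by norm_num⟩) (by norm_num) 0 0 0 4 0 (by decide +kernel)]
    decide +kernel

/-! ## `5` is good ordinary for every `E_{m,n}` -/

/-- **`q = 5` is a prime of good ORDINARY reduction of `E_{m,n}` for every admissible `(m, n)`** (on the global
minimal model, instances `isElliptic_zywinaCurve h`, `isGloballyMinimal_zywinaCurve h`): `5 ∤ Δ_min` and
`a₅(E_{m,n}) = 6 − #Ẽ(𝔽₅) ∈ {±2, ±4}`. UNCONDITIONAL. [cite: SilvermanAEC2009, VII.5 Prop. 5.1 (a) and V.4]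
[cite: IrelandRosen1990, §18.4] -/
theorem goodOrdinary_five_zywinaCurve (h : ZywinaAdmissible m n) [(zywinaCurve m n).IsGloballyMinimal]
    [Fact (Nat.Prime 5)] :
    (zywinaCurve m n).HasGoodReductionAtPrime 5 ∧ ¬ ((5 : ℕ) : ℤ) ∣ (zywinaCurve m n).frobeniusTrace 5 := by
  have hI : integralModelInt (zywinaCurve m n) = zywinaCurveInt m n := by
    convert integralModelInt_zywinaCurve h
  refine ⟨hasGoodReductionAtPrime_of_not_dvd _ 5 ?_, ?_⟩
  · rw [IntModel.minimalDiscriminantInt_eq hI]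
    exact_mod_cast five_not_dvd_Δ_zywinaCurveInt h
  · rw [IntModel.frobeniusTrace_eq hI rfl, map_zywinaCurveInt_zmod_five]
    exact_mod_cast natCard_five_of_residue _ (residue_five_mem h)

/-- `5` is good ordinary for `E_{m,n}` in the `IsOrdinaryAt` packaging. [cite: SilvermanAEC2009, VII.5 Prop. 5.1 (a)] -/
theorem isOrdinaryAt_five_zywinaCurve (h : ZywinaAdmissible m n) [(zywinaCurve m n).IsGloballyMinimal]
    [Fact (Nat.Prime 5)] : IsOrdinaryAt (zywinaCurve m n) 5 :=
  goodOrdinary_five_zywinaCurve h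

/-! ## The transfer's instances at the uniform target `q = 5` -/

/-- **The cross-prime row at `q = 5`, family-wide.** Granting Kato's Thm. 18.4 at `5` for `E_{m,n}` (named fact,
`f` its newform) and the certificate `[T²] L_5(E_{m,n}, T) ≠ 0`: `Ш(E_{m,n})[5^∞]` finite,
`corank_{ℤ₅} Sel_{5^∞}(E_{m,n}/ℚ) = 2`, `t_5(E_{m,n}) = 0`, `ord_{T=0} L_5(E_{m,n}, T) = 2` — T's instance
`(E_{m,n}, 2, 5)` verified modulo print + one certificate per curve. CONDITIONAL on `hK`, `hf`, `hcoeff`.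
[cite: Kato2004Asterisque, Thm. 18.4 (p. 281)] [cite: SteinWuthrich2013, Algorithm 11.1 (3) (p. 27)] -/
theorem crossPrimeRow_five_zywinaCurve (h : ZywinaAdmissible m n) [(zywinaCurve m n).IsElliptic]
    [(zywinaCurve m n).IsGloballyMinimal] [Fact (Nat.Prime 5)] {N : ℕ} [NeZero N] {f : CuspForm (Gamma0 N) 2}
    (hK : kato_selmerCorank_le_order_padicLFunction (zywinaCurve m n) 5 (f := f))
    (hf : IsNewformOf (zywinaCurve m n) f)
    (hcoeff : PowerSeries.coeff 2 (padicLFunction f (unitRoot (zywinaCurve m n) 5 : ℚ_[5])) ≠ 0) :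
    Finite ↥(AddCommGroup.primaryComponent (zywinaCurve m n).sha 5) ∧
      (zywinaCurve m n).selmerCorank 5 = 2 ∧ (zywinaCurve m n).shaCorank 5 = 0 ∧
      (padicLFunction f (unitRoot (zywinaCurve m n) 5 : ℚ_[5])).order = 2 := by
  obtain ⟨hfin, -, hsel, hsha, hordr⟩ :=
    finite_sha_primary_of_coeff_padicLFunction_ne_zero (zywinaCurve m n) 5 hK (by decide)
      (isOrdinaryAt_five_zywinaCurve h) hf hcoeff (by rw [mordellWeilRank_zywinaCurve h])
  exact ⟨hfin, hsel, hsha, by rw [hordr]; rfl⟩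

/-- **X2 at the uniform target.** Granting X2 = `AnalyticRankLeSelmerCorank` at `q = 5`:
`ord_{s=1} L(E_{m,n}, s) ≤ 2 + t_5(E_{m,n})` for every admissible `(m, n)`. CONDITIONAL on `hX2`.
[cite: GreenbergLNM1716, §1 (pp. 54–57)] -/
theorem analyticRank_zywinaCurve_le_of_X2_five (hX2 : AnalyticRankLeSelmerCorank) (h : ZywinaAdmissible m n)
    [(zywinaCurve m n).IsElliptic] [(zywinaCurve m n).IsGloballyMinimal] [Fact (Nat.Prime 5)] :
    (zywinaCurve m n).analyticRank ≤ 2 + (zywinaCurve m n).shaCorank 5 := by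
  obtain ⟨hgood, hord⟩ := goodOrdinary_five_zywinaCurve h
  have hle := hX2 (zywinaCurve m n) 5 (by norm_num) hgood hord
  rw [(zywinaCurve m n).selmerCorank_eq_mordellWeilRank_add_holds 5, mordellWeilRank_zywinaCurve h] at hle
  exact hle

/-- **X2 ∧ T at the uniform target**: `ord_{s=1} L(E_{m,n}, s) ≤ 2` — the transfer carrying the PROVED `t_2 = 0` to
`t_5 = 0` at the PROVED good ordinary prime `5`. CONDITIONAL on `hX2`, `hT`. [cite: GreenbergLNM1716, §1 (pp. 54–57)] -/
theorem analyticRank_zywinaCurve_le_two_of_X2_five_of_transfer (hX2 : AnalyticRankLeSelmerCorank)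
    (hT : FiniteShaComponentTransfer) (h : ZywinaAdmissible m n) [(zywinaCurve m n).IsElliptic]
    [(zywinaCurve m n).IsGloballyMinimal] [Fact (Nat.Prime 5)] : (zywinaCurve m n).analyticRank ≤ 2 := by
  have hle := analyticRank_zywinaCurve_le_of_X2_five hX2 h
  rw [hT (zywinaCurve m n) 2 5 (shaCorank_two_zywinaCurve h), add_zero] at hle
  exact hle

end Summit.BirchSwinnertonDyer.BirchSwinnertonDyer.Theorems.ShaPrimaryTransferGoodOrdinaryFive
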